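import Mathlib
import HarnessLib
import Summits.HubbardSuperconductivity.HubbardSuperconductivity.Theorems.KLProgrammeKLRegimeCountertermJacksonHighPart
import Summits.HubbardSuperconductivity.HubbardSuperconductivity.Theorems.KLProgrammeKLRegimeCountertermJacksonKernelSharp

/-!
# Route `KLProgramme`, crux K3 — gen-8 ENGINE-FLOW child (stmt-HubbardSuperconductivity-20437 `KLRegimeEngineV17F2`), stub (C)
# `stub_twoLeg_curvature`, door (C1) «Jackson remainder», part 1: derivatives of `F − 𝒥_d F` at a point from LOCAL symbol sizes
# (near square of the smoothing variable) and GLOBAL sizes (far region), with the sharp kernel constants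

Seat hubbard-kl-k3c3-p1 (g5).  In c4a-1's decomposition of the cumulative reading under scheme F (KL STATUS 2026-08-27 l.2674/2731) the term (C1)
is the Jackson remainder `jhigh1 d F = F − 𝒥_d F` of `F := klFrameExtFn μ f_{n−1}` (`d = klFlowDeg (n−1)`) read along the new flow curve.  Near the
curve (inside the flat tube) `F` has SMALL derivatives (angular jets of `f` over powers of `|q|`); in the cutoff zone they are LARGE.  The Jackson mean
is local up to its cubic tails, so the right bound splits the smoothing variable `w = (s,t)` into the NEAR square `|s|, |t| ≤ δ` (mean value with the
local size of the next derivative — the first-order Jackson gain `3π/(d+1)`) and the FAR region (triangle inequality with the global size, weighted by the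
kernel mass `≤ π³/((d+1)δ)³`):

* §1 two-dimensional kernel facts with the constants of `…JacksonKernelSharp` (p530419): `integral_jweight_mul_absSum_le_threePi` (`∫J̃J̃(|s|+|t|) ≤ 3π/(d+1)`;
  the tree's twin has `π⁶`), the far indicator `Set.indicator {s : ℝ | δ < |s|} (1 : ℝ → ℝ) s = 𝟙_{δ<|s|}`, `integral_jker_mul_jfar_le`, **`integral_jweight_mul_jfar_le`** (`≤ π³/((d+1)δ)³`);
* §2 `norm_iteratedFDeriv_translate_sub_le(_top)` (pointwise majorants) and **`norm_iteratedFDeriv_jhigh1_le_local`** (`j ≤ 3`: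
  `‖Dʲ(F − 𝒥_dF)(x)‖ ≤ Ml (j+1)·m₁ + (B j + Ml j)·π³/((d+1)δ)³` for any first-moment bound `∫J̃J̃(|s|+|t|) ≤ m₁`, e.g. `3π/(d+1)`), **`norm_iteratedFDeriv_jhigh1_le_local_top`** (`j ≤ 4`: `2·Ml j + B j·π³/((d+1)δ)³`),
  for `‖DⁱF‖ ≤ Ml i` on the ball `‖y − x‖ ≤ r ⊇` near square (`2δ ≤ r`) and `‖DⁱF‖ ≤ B i` everywhere.

Part 2 (`…JacksonRemainderCurve`) composes with the curve.  Numerology: evidence `JACKSON-REMAINDER-NUMEROLOGY.md` on 20437.  Pure real analysis; no definitions; nothing about the model; nothing here asserts superconductivity.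
-/

noncomputable section

namespace Summit.HubbardSuperconductivity.HubbardSuperconductivity.Theorems.KLRegimeSplit

set_option linter.dupNamespace false -- summit = problem name (single-conjunct summit), D-0017

open Real MeasureTheory Filter
open Literature.Analysis.Fourier.TrigApprox Literature.MathematicalPhysics.QuantumLattice

/-! ## §1 Two-dimensional kernel facts with sharp constants: first moment, far indicator, far mass -/

section Kernel

variable (d : ℕ)

/-- **`∫ J̃J̃·(|s| + |t|) dμ ≤ 3π/(d+1)`** (twin of `integral_jweight_mul_absSum_le`, whose constant is `π⁶`; k3c3-p3's `…JacksonSharpMoments` sharpens `3π` to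
`π√3` — the bounds of §2 take the first-moment constant `m₁` as a HYPOTHESIS so that either instance plugs in). -/
theorem integral_jweight_mul_absSum_le_threePi : ∫ w, jweight d w * (|w.1| + |w.2|) ∂jmeas ≤ 3 * π / (d + 1) := by
  have hππ : -π ≤ π := by linarith [Real.pi_pos]
  have hm := integral_abs_mul_jker_le_sharp d
  have e : (fun w : ℝ × ℝ => jweight d w * (|w.1| + |w.2|)) =
      fun w => (|w.1| * jker d w.1) * jker d w.2 + jker d w.1 * (|w.2| * jker d w.2) := by
    funext w; simp only [jweight]; ring
  have hj1 : Continuous fun w : ℝ × ℝ => jker d w.1 := (continuous_jker d).comp continuous_fst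
  have hj2 : Continuous fun w : ℝ × ℝ => jker d w.2 := (continuous_jker d).comp continuous_snd
  have i1 : Integrable (fun w : ℝ × ℝ => (|w.1| * jker d w.1) * jker d w.2) jmeas :=
    integrable_jmeas_of_continuous ((continuous_fst.abs.mul hj1).mul hj2)
  have i2 : Integrable (fun w : ℝ × ℝ => jker d w.1 * (|w.2| * jker d w.2)) jmeas :=
    integrable_jmeas_of_continuous (hj1.mul (continuous_snd.abs.mul hj2))
  rw [e, integral_add i1 i2,
    MeasureTheory.integral_prod_mul (μ := volume.restrict (Set.Ioc (-π) π)) (ν := volume.restrict (Set.Ioc (-π) π))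
      (f := fun s => |s| * jker d s) (g := fun t => jker d t),
    MeasureTheory.integral_prod_mul (μ := volume.restrict (Set.Ioc (-π) π)) (ν := volume.restrict (Set.Ioc (-π) π))
      (f := fun s => jker d s) (g := fun t => |t| * jker d t)]
  simp only [← intervalIntegral.integral_of_le hππ, integral_jker]
  have e2 : (∫ x in (-π)..π, |x| * jker d x) * 1 + 1 * ∫ x in (-π)..π, |x| * jker d x =
      2 * ∫ x in (-π)..π, |x| * jker d x := by ring
  rw [e2]
  have hd : (0 : ℝ) < d + 1 := by positivity
  have : 2 * (3 * π / (2 * ((d : ℝ) + 1))) = 3 * π / (d + 1) := by field_simp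
  linarith

/-- The FAR INDICATOR of the smoothing variable is `Set.indicator {s | δ < |s|} 1` (`1` where `|s| > δ`, `0` where `|s| ≤ δ`); it is nonnegative. -/
theorem jfar_nonneg (δ s : ℝ) : 0 ≤ Set.indicator {s : ℝ | δ < |s|} (1 : ℝ → ℝ) s := by
  rw [Set.indicator_apply]; split_ifs <;> simp

/-- The far indicator is `≤ 1`. -/
theorem jfar_le_one (δ s : ℝ) : Set.indicator {s : ℝ | δ < |s|} (1 : ℝ → ℝ) s ≤ 1 := by
  rw [Set.indicator_apply]; split_ifs <;> simp

/-- Inside: the far indicator vanishes for `|s| ≤ δ`. -/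
theorem jfar_eq_zero {δ s : ℝ} (h : |s| ≤ δ) : Set.indicator {s : ℝ | δ < |s|} (1 : ℝ → ℝ) s = 0 := by
  rw [Set.indicator_apply, if_neg (by simpa using h)]

/-- Outside: the far indicator is `1` for `δ < |s|`. -/
theorem jfar_eq_one {δ s : ℝ} (h : δ < |s|) : Set.indicator {s : ℝ | δ < |s|} (1 : ℝ → ℝ) s = 1 := by
  rw [Set.indicator_apply, if_pos (by simpa using h)]; rfl

/-- The far set is measurable. -/
theorem measurableSet_jfar (δ : ℝ) : MeasurableSet {s : ℝ | δ < |s|} :=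
  measurableSet_lt measurable_const continuous_abs.measurable

/-- `J̃·𝟙_far` is interval integrable. -/
theorem intervalIntegrable_jker_mul_jfar (δ a b : ℝ) : IntervalIntegrable (fun s => jker d s * Set.indicator {s : ℝ | δ < |s|} (1 : ℝ → ℝ) s) volume a b := by
  have e : (fun s => jker d s * Set.indicator {s : ℝ | δ < |s|} (1 : ℝ → ℝ) s) = Set.indicator {s : ℝ | δ < |s|} (jker d) := by
    funext s
    by_cases hs : s ∈ {s : ℝ | δ < |s|}
    · rw [Set.indicator_of_mem hs, Set.indicator_of_mem hs, Pi.one_apply, mul_one]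
    · rw [Set.indicator_of_notMem hs, Set.indicator_of_notMem hs, mul_zero]
  rw [e]
  exact ((continuous_jker d).intervalIntegrable a b).1.indicator (measurableSet_jfar δ) |> fun h =>
    ⟨h, ((continuous_jker d).intervalIntegrable a b).2.indicator (measurableSet_jfar δ)⟩

/-- **One-dimensional far mass**: `∫_{−π}^{π} J̃_d·𝟙_{|s|>δ} ≤ π³/(2((d+1)δ)³)` for `0 < δ ≤ π`. -/
theorem integral_jker_mul_jfar_le {δ : ℝ} (hδ : 0 < δ) (hδπ : δ ≤ π) :
    ∫ s in (-π)..π, jker d s * Set.indicator {s : ℝ | δ < |s|} (1 : ℝ → ℝ) s ≤ π ^ 3 / (2 * ((d + 1) * δ) ^ 3) := by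
  have hI := intervalIntegrable_jker_mul_jfar d δ
  rw [← intervalIntegral.integral_add_adjacent_intervals (hI (-π) (-δ)) (hI (-δ) π),
    ← intervalIntegral.integral_add_adjacent_intervals (hI (-δ) δ) (hI δ π)]
  -- middle: zero
  have hmid : ∫ s in (-δ)..δ, jker d s * Set.indicator {s : ℝ | δ < |s|} (1 : ℝ → ℝ) s = 0 := by
    rw [intervalIntegral.integral_congr (g := fun _ => (0 : ℝ)) fun s hs => ?_, intervalIntegral.integral_zero]
    rw [Set.uIcc_of_le (by linarith)] at hs
    show jker d s * Set.indicator {s : ℝ | δ < |s|} (1 : ℝ → ℝ) s = 0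
    rw [jfar_eq_zero (abs_le.mpr ⟨hs.1, hs.2⟩), mul_zero]
  -- right: ≤ tail
  have hright : ∫ s in δ..π, jker d s * Set.indicator {s : ℝ | δ < |s|} (1 : ℝ → ℝ) s ≤ π ^ 3 / (4 * ((d + 1) * δ) ^ 3) := by
    refine le_trans ?_ (integral_jker_tail_le d hδ hδπ)
    refine intervalIntegral.integral_mono_on hδπ (hI δ π) ((continuous_jker d).intervalIntegrable _ _) fun s _ => ?_
    calc jker d s * Set.indicator {s : ℝ | δ < |s|} (1 : ℝ → ℝ) s ≤ jker d s * 1 := mul_le_mul_of_nonneg_left (jfar_le_one δ s) (jker_nonneg d s)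
      _ = jker d s := mul_one _
  -- left: by evenness, equal to the right tail
  have hleft : ∫ s in (-π)..(-δ), jker d s * Set.indicator {s : ℝ | δ < |s|} (1 : ℝ → ℝ) s ≤ π ^ 3 / (4 * ((d + 1) * δ) ^ 3) := by
    have hsym : ∫ s in (-π)..(-δ), jker d s * Set.indicator {s : ℝ | δ < |s|} (1 : ℝ → ℝ) s = ∫ s in δ..π, jker d s * Set.indicator {s : ℝ | δ < |s|} (1 : ℝ → ℝ) s := by
      have h := intervalIntegral.integral_comp_neg (a := δ) (b := π) (fun s => jker d s * Set.indicator {s : ℝ | δ < |s|} (1 : ℝ → ℝ) s)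
      -- `∫_{δ}^{π} f(−s) ds = ∫_{−π}^{−δ} f(s) ds`
      rw [← h]
      refine intervalIntegral.integral_congr fun s _ => ?_
      show jker d (-s) * Set.indicator {s : ℝ | δ < |s|} (1 : ℝ → ℝ) (-s) = jker d s * Set.indicator {s : ℝ | δ < |s|} (1 : ℝ → ℝ) s
      rw [jker_neg]; simp only [Set.indicator_apply, Set.mem_setOf_eq, abs_neg, Pi.one_apply]
    rw [hsym]; exact hright
  have hd : (0 : ℝ) < ((d : ℝ) + 1) * δ := by positivity
  have e : π ^ 3 / (4 * ((d + 1) * δ) ^ 3) + π ^ 3 / (4 * ((d + 1) * δ) ^ 3) = π ^ 3 / (2 * (((d : ℝ) + 1) * δ) ^ 3) := by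
    field_simp; ring
  linarith

/-- `J̃J̃·𝟙_far(s)` is integrable on the smoothing square. -/
theorem integrable_jweight_mul_jfar_fst (δ : ℝ) : Integrable (fun w : ℝ × ℝ => jweight d w * Set.indicator {s : ℝ | δ < |s|} (1 : ℝ → ℝ) w.1) jmeas := by
  have e : (fun w : ℝ × ℝ => jweight d w * Set.indicator {s : ℝ | δ < |s|} (1 : ℝ → ℝ) w.1) = Set.indicator {w : ℝ × ℝ | δ < |w.1|} (jweight d) := by
    funext w
    by_cases hw : w ∈ {w : ℝ × ℝ | δ < |w.1|}
    · rw [Set.indicator_of_mem hw, jfar_eq_one (by simpa using hw), mul_one]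
    · rw [Set.indicator_of_notMem hw, jfar_eq_zero (by simpa using hw), mul_zero]
  rw [e]
  exact (integrable_jmeas_of_continuous (continuous_jweight d)).indicator
    (measurableSet_lt measurable_const (continuous_abs.comp continuous_fst).measurable)

/-- `J̃J̃·𝟙_far(t)` is integrable on the smoothing square. -/
theorem integrable_jweight_mul_jfar_snd (δ : ℝ) : Integrable (fun w : ℝ × ℝ => jweight d w * Set.indicator {s : ℝ | δ < |s|} (1 : ℝ → ℝ) w.2) jmeas := by
  have e : (fun w : ℝ × ℝ => jweight d w * Set.indicator {s : ℝ | δ < |s|} (1 : ℝ → ℝ) w.2) = Set.indicator {w : ℝ × ℝ | δ < |w.2|} (jweight d) := by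
    funext w
    by_cases hw : w ∈ {w : ℝ × ℝ | δ < |w.2|}
    · rw [Set.indicator_of_mem hw, jfar_eq_one (by simpa using hw), mul_one]
    · rw [Set.indicator_of_notMem hw, jfar_eq_zero (by simpa using hw), mul_zero]
  rw [e]
  exact (integrable_jmeas_of_continuous (continuous_jweight d)).indicator
    (measurableSet_lt measurable_const (continuous_abs.comp continuous_snd).measurable)

/-- **Two-dimensional far mass**: `∫ J̃J̃·(𝟙_{|s|>δ} + 𝟙_{|t|>δ}) dμ ≤ π³/((d+1)δ)³`. -/
theorem integral_jweight_mul_jfar_le {δ : ℝ} (hδ : 0 < δ) (hδπ : δ ≤ π) :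
    ∫ w, jweight d w * (Set.indicator {s : ℝ | δ < |s|} (1 : ℝ → ℝ) w.1 + Set.indicator {s : ℝ | δ < |s|} (1 : ℝ → ℝ) w.2) ∂jmeas ≤ π ^ 3 / ((d + 1) * δ) ^ 3 := by
  have hππ : -π ≤ π := by linarith [Real.pi_pos]
  have h1 := integral_jker_mul_jfar_le d hδ hδπ
  have e : (fun w : ℝ × ℝ => jweight d w * (Set.indicator {s : ℝ | δ < |s|} (1 : ℝ → ℝ) w.1 + Set.indicator {s : ℝ | δ < |s|} (1 : ℝ → ℝ) w.2)) =
      fun w => (jker d w.1 * Set.indicator {s : ℝ | δ < |s|} (1 : ℝ → ℝ) w.1) * jker d w.2 + jker d w.1 * (jker d w.2 * Set.indicator {s : ℝ | δ < |s|} (1 : ℝ → ℝ) w.2) := by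
    funext w; simp only [jweight]; ring
  have i1 : Integrable (fun w : ℝ × ℝ => (jker d w.1 * Set.indicator {s : ℝ | δ < |s|} (1 : ℝ → ℝ) w.1) * jker d w.2) jmeas := by
    have := integrable_jweight_mul_jfar_fst d δ
    refine this.congr (Eventually.of_forall fun w => ?_)
    simp only [jweight]; ring
  have i2 : Integrable (fun w : ℝ × ℝ => jker d w.1 * (jker d w.2 * Set.indicator {s : ℝ | δ < |s|} (1 : ℝ → ℝ) w.2)) jmeas := by
    have := integrable_jweight_mul_jfar_snd d δ
    refine this.congr (Eventually.of_forall fun w => ?_)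
    simp only [jweight]; ring
  rw [e, integral_add i1 i2,
    MeasureTheory.integral_prod_mul (μ := volume.restrict (Set.Ioc (-π) π)) (ν := volume.restrict (Set.Ioc (-π) π))
      (f := fun s => jker d s * Set.indicator {s : ℝ | δ < |s|} (1 : ℝ → ℝ) s) (g := fun t => jker d t),
    MeasureTheory.integral_prod_mul (μ := volume.restrict (Set.Ioc (-π) π)) (ν := volume.restrict (Set.Ioc (-π) π))
      (f := fun s => jker d s) (g := fun t => jker d t * Set.indicator {s : ℝ | δ < |s|} (1 : ℝ → ℝ) t)]
  simp only [← intervalIntegral.integral_of_le hππ, integral_jker]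
  have hd : (0 : ℝ) < ((d : ℝ) + 1) * δ := by positivity
  have e2 : π ^ 3 / (2 * ((d + 1) * δ) ^ 3) + π ^ 3 / (2 * ((d + 1) * δ) ^ 3) = π ^ 3 / ((((d : ℝ) + 1) * δ) ^ 3) := by
    field_simp; ring
  linarith

end Kernel

/-! ## §2 The Jackson remainder `jhigh1 d F = F − 𝒥_d F`: derivatives from LOCAL sizes near the point and GLOBAL sizes on the far region -/

section Local

variable {F : (Fin 2 → ℝ) → ℝ} {B : ℕ → ℝ} {x : EuclideanSpace ℝ (Fin 2)} {r : ℝ} {Ml : ℕ → ℝ} {δ : ℝ}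

/-- The local sizes are nonnegative (at the centre). -/
theorem ml_nonneg
    (hMl : ∀ i ≤ 4, ∀ y : EuclideanSpace ℝ (Fin 2), ‖y - x‖ ≤ r →
      ‖iteratedFDeriv ℝ i (fun q : EuclideanSpace ℝ (Fin 2) => F (WithLp.ofLp q)) y‖ ≤ Ml i)
    (hδ : 0 < δ) (hδr : 2 * δ ≤ r) {i : ℕ} (hi : i ≤ 4) : 0 ≤ Ml i :=
  (norm_nonneg _).trans (hMl i hi x (by simp; linarith))

/-- **Pointwise majorant of the difference of derivatives along a translate** (`j + 1 ≤ 4`):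
`‖DʲG(x − v_w) − DʲG(x)‖ ≤ Ml (j+1)·(|s|+|t|) + (B j + Ml j)·(𝟙_{|s|>δ} + 𝟙_{|t|>δ})` (mean value on the near square, triangle on the far region). -/
theorem norm_iteratedFDeriv_translate_sub_le
    (hG : ContDiff ℝ 4 (fun q : EuclideanSpace ℝ (Fin 2) => F (WithLp.ofLp q)))
    (hB : ∀ i ≤ 4, ∀ y, ‖iteratedFDeriv ℝ i (fun q : EuclideanSpace ℝ (Fin 2) => F (WithLp.ofLp q)) y‖ ≤ B i)
    (hMl : ∀ i ≤ 4, ∀ y : EuclideanSpace ℝ (Fin 2), ‖y - x‖ ≤ r →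
      ‖iteratedFDeriv ℝ i (fun q : EuclideanSpace ℝ (Fin 2) => F (WithLp.ofLp q)) y‖ ≤ Ml i)
    (hδ : 0 < δ) (hδr : 2 * δ ≤ r) {j : ℕ} (hj : j + 1 ≤ 4) (w : ℝ × ℝ) :
    ‖iteratedFDeriv ℝ j (fun q : EuclideanSpace ℝ (Fin 2) => F (WithLp.ofLp q)) (x - jshift w) -
        iteratedFDeriv ℝ j (fun q : EuclideanSpace ℝ (Fin 2) => F (WithLp.ofLp q)) x‖ ≤
      Ml (j + 1) * (|w.1| + |w.2|) + (B j + Ml j) * (Set.indicator {s : ℝ | δ < |s|} (1 : ℝ → ℝ) w.1 + Set.indicator {s : ℝ | δ < |s|} (1 : ℝ → ℝ) w.2) := by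
  set G : EuclideanSpace ℝ (Fin 2) → ℝ := fun q => F (WithLp.ofLp q) with hGdef
  have hB0 : 0 ≤ B j := (norm_nonneg _).trans (hB j (by omega) x)
  have hM0 : 0 ≤ Ml j := ml_nonneg hMl hδ hδr (by omega)
  have hM1 : 0 ≤ Ml (j + 1) := ml_nonneg hMl hδ hδr hj
  by_cases hnear : |w.1| ≤ δ ∧ |w.2| ≤ δ
  · -- near: mean value inequality on the ball of radius `r`
    have hv : ‖jshift w‖ ≤ r := (norm_jshift_le w).trans (by linarith [hnear.1, hnear.2])
    have hdiff : ∀ y ∈ Metric.closedBall x r, DifferentiableAt ℝ (iteratedFDeriv ℝ j G) y := fun y _ =>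
      (hG.differentiable_iteratedFDeriv (by exact_mod_cast (show j < 4 by omega))) y
    have hbound : ∀ y ∈ Metric.closedBall x r, ‖fderiv ℝ (iteratedFDeriv ℝ j G) y‖ ≤ Ml (j + 1) := by
      intro y hy
      rw [norm_fderiv_iteratedFDeriv]
      exact hMl (j + 1) hj y (by rwa [Metric.mem_closedBall, dist_eq_norm] at hy)
    have hx : x ∈ Metric.closedBall x r := Metric.mem_closedBall_self (by linarith)
    have hxv : x - jshift w ∈ Metric.closedBall x r := by
      rw [Metric.mem_closedBall, dist_eq_norm, sub_sub_cancel_left, norm_neg]; exact hv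
    have hmv := (convex_closedBall x r).norm_image_sub_le_of_norm_fderiv_le hdiff hbound hx hxv
    rw [sub_sub_cancel_left, norm_neg] at hmv
    calc ‖iteratedFDeriv ℝ j G (x - jshift w) - iteratedFDeriv ℝ j G x‖ ≤ Ml (j + 1) * ‖jshift w‖ := hmv
      _ ≤ Ml (j + 1) * (|w.1| + |w.2|) := mul_le_mul_of_nonneg_left (norm_jshift_le w) hM1
      _ ≤ Ml (j + 1) * (|w.1| + |w.2|) + (B j + Ml j) * (Set.indicator {s : ℝ | δ < |s|} (1 : ℝ → ℝ) w.1 + Set.indicator {s : ℝ | δ < |s|} (1 : ℝ → ℝ) w.2) :=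
          le_add_of_nonneg_right (mul_nonneg (add_nonneg hB0 hM0) (add_nonneg (jfar_nonneg _ _) (jfar_nonneg _ _)))
  · -- far: triangle inequality, and at least one indicator is `1`
    have hind : (1 : ℝ) ≤ Set.indicator {s : ℝ | δ < |s|} (1 : ℝ → ℝ) w.1 + Set.indicator {s : ℝ | δ < |s|} (1 : ℝ → ℝ) w.2 := by
      rcases not_and_or.mp hnear with h1 | h2
      · rw [jfar_eq_one (not_le.mp h1)]; linarith [jfar_nonneg δ w.2]
      · rw [jfar_eq_one (not_le.mp h2)]; linarith [jfar_nonneg δ w.1]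
    have hxx : ‖x - x‖ ≤ r := by simp; linarith
    calc ‖iteratedFDeriv ℝ j G (x - jshift w) - iteratedFDeriv ℝ j G x‖
        ≤ ‖iteratedFDeriv ℝ j G (x - jshift w)‖ + ‖iteratedFDeriv ℝ j G x‖ := norm_sub_le _ _
      _ ≤ B j + Ml j := add_le_add (hB j (by omega) _) (hMl j (by omega) x hxx)
      _ ≤ (B j + Ml j) * (Set.indicator {s : ℝ | δ < |s|} (1 : ℝ → ℝ) w.1 + Set.indicator {s : ℝ | δ < |s|} (1 : ℝ → ℝ) w.2) := le_mul_of_one_le_right (add_nonneg hB0 hM0) hind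
      _ ≤ Ml (j + 1) * (|w.1| + |w.2|) + (B j + Ml j) * (Set.indicator {s : ℝ | δ < |s|} (1 : ℝ → ℝ) w.1 + Set.indicator {s : ℝ | δ < |s|} (1 : ℝ → ℝ) w.2) :=
          le_add_of_nonneg_left (mul_nonneg hM1 (add_nonneg (abs_nonneg _) (abs_nonneg _)))

/-- **Pointwise majorant without gain** (`j ≤ 4`): `‖DʲG(x − v_w) − DʲG(x)‖ ≤ 2·Ml j + B j·(𝟙_{|s|>δ} + 𝟙_{|t|>δ})`. -/
theorem norm_iteratedFDeriv_translate_sub_le_top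
    (hB : ∀ i ≤ 4, ∀ y, ‖iteratedFDeriv ℝ i (fun q : EuclideanSpace ℝ (Fin 2) => F (WithLp.ofLp q)) y‖ ≤ B i)
    (hMl : ∀ i ≤ 4, ∀ y : EuclideanSpace ℝ (Fin 2), ‖y - x‖ ≤ r →
      ‖iteratedFDeriv ℝ i (fun q : EuclideanSpace ℝ (Fin 2) => F (WithLp.ofLp q)) y‖ ≤ Ml i)
    (hδ : 0 < δ) (hδr : 2 * δ ≤ r) {j : ℕ} (hj : j ≤ 4) (w : ℝ × ℝ) :
    ‖iteratedFDeriv ℝ j (fun q : EuclideanSpace ℝ (Fin 2) => F (WithLp.ofLp q)) (x - jshift w) -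
        iteratedFDeriv ℝ j (fun q : EuclideanSpace ℝ (Fin 2) => F (WithLp.ofLp q)) x‖ ≤
      2 * Ml j + B j * (Set.indicator {s : ℝ | δ < |s|} (1 : ℝ → ℝ) w.1 + Set.indicator {s : ℝ | δ < |s|} (1 : ℝ → ℝ) w.2) := by
  set G : EuclideanSpace ℝ (Fin 2) → ℝ := fun q => F (WithLp.ofLp q) with hGdef
  have hB0 : 0 ≤ B j := (norm_nonneg _).trans (hB j hj x)
  have hM0 : 0 ≤ Ml j := ml_nonneg hMl hδ hδr hj
  have hxx : ‖x - x‖ ≤ r := by simp; linarith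
  have hx0 := hMl j hj x hxx
  by_cases hnear : |w.1| ≤ δ ∧ |w.2| ≤ δ
  · have hv : ‖jshift w‖ ≤ r := (norm_jshift_le w).trans (by linarith [hnear.1, hnear.2])
    have hxv : ‖(x - jshift w) - x‖ ≤ r := by rw [sub_sub_cancel_left, norm_neg]; exact hv
    calc ‖iteratedFDeriv ℝ j G (x - jshift w) - iteratedFDeriv ℝ j G x‖
        ≤ ‖iteratedFDeriv ℝ j G (x - jshift w)‖ + ‖iteratedFDeriv ℝ j G x‖ := norm_sub_le _ _
      _ ≤ Ml j + Ml j := add_le_add (hMl j hj _ hxv) hx0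
      _ = 2 * Ml j := by ring
      _ ≤ 2 * Ml j + B j * (Set.indicator {s : ℝ | δ < |s|} (1 : ℝ → ℝ) w.1 + Set.indicator {s : ℝ | δ < |s|} (1 : ℝ → ℝ) w.2) :=
          le_add_of_nonneg_right (mul_nonneg hB0 (add_nonneg (jfar_nonneg _ _) (jfar_nonneg _ _)))
  · have hind : (1 : ℝ) ≤ Set.indicator {s : ℝ | δ < |s|} (1 : ℝ → ℝ) w.1 + Set.indicator {s : ℝ | δ < |s|} (1 : ℝ → ℝ) w.2 := by
      rcases not_and_or.mp hnear with h1 | h2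
      · rw [jfar_eq_one (not_le.mp h1)]; linarith [jfar_nonneg δ w.2]
      · rw [jfar_eq_one (not_le.mp h2)]; linarith [jfar_nonneg δ w.1]
    calc ‖iteratedFDeriv ℝ j G (x - jshift w) - iteratedFDeriv ℝ j G x‖
        ≤ ‖iteratedFDeriv ℝ j G (x - jshift w)‖ + ‖iteratedFDeriv ℝ j G x‖ := norm_sub_le _ _
      _ ≤ B j + Ml j := add_le_add (hB j hj _) hx0
      _ ≤ B j * (Set.indicator {s : ℝ | δ < |s|} (1 : ℝ → ℝ) w.1 + Set.indicator {s : ℝ | δ < |s|} (1 : ℝ → ℝ) w.2) + 2 * Ml j := by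
          have := le_mul_of_one_le_right hB0 hind; linarith
      _ = 2 * Ml j + B j * (Set.indicator {s : ℝ | δ < |s|} (1 : ℝ → ℝ) w.1 + Set.indicator {s : ℝ | δ < |s|} (1 : ℝ → ℝ) w.2) := by ring

/-- **The Jackson remainder's derivatives from local sizes, WITH the first-order gain** (`j + 1 ≤ 4`): for any first-moment bound
`∫J̃J̃(|s|+|t|) ≤ m₁` (`3π/(d+1)` here, `π√3/(d+1)` in `…JacksonSharpMoments`): `‖Dʲ(F − 𝒥_dF)(x)‖ ≤ Ml (j+1)·m₁ + (B j + Ml j)·π³/((d+1)δ)³`. -/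
theorem norm_iteratedFDeriv_jhigh1_le_local (d : ℕ) (hF : Continuous F)
    (hG : ContDiff ℝ 4 (fun q : EuclideanSpace ℝ (Fin 2) => F (WithLp.ofLp q)))
    (hB : ∀ i ≤ 4, ∀ y, ‖iteratedFDeriv ℝ i (fun q : EuclideanSpace ℝ (Fin 2) => F (WithLp.ofLp q)) y‖ ≤ B i)
    (hMl : ∀ i ≤ 4, ∀ y : EuclideanSpace ℝ (Fin 2), ‖y - x‖ ≤ r →
      ‖iteratedFDeriv ℝ i (fun q : EuclideanSpace ℝ (Fin 2) => F (WithLp.ofLp q)) y‖ ≤ Ml i)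
    (hδ : 0 < δ) (hδπ : δ ≤ π) (hδr : 2 * δ ≤ r) {m₁ : ℝ} (hm₁ : ∫ w, jweight d w * (|w.1| + |w.2|) ∂jmeas ≤ m₁)
    {j : ℕ} (hj : j + 1 ≤ 4) :
    ‖iteratedFDeriv ℝ j (fun q : EuclideanSpace ℝ (Fin 2) => jhigh1 d F (WithLp.ofLp q)) x‖ ≤
      Ml (j + 1) * m₁ + (B j + Ml j) * (π ^ 3 / ((d + 1) * δ) ^ 3) := by
  set G : EuclideanSpace ℝ (Fin 2) → ℝ := fun q => F (WithLp.ofLp q) with hGdef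
  have hB0 : 0 ≤ B j := (norm_nonneg _).trans (hB j (by omega) x)
  have hM0 : 0 ≤ Ml j := ml_nonneg hMl hδ hδr (by omega)
  have hM1 : 0 ≤ Ml (j + 1) := ml_nonneg hMl hδ hδr hj
  rw [iteratedFDeriv_jhigh1_eq d hF hG hB (Nat.le_of_succ_le hj) x, norm_neg]
  set maj : ℝ × ℝ → ℝ := fun w => Ml (j + 1) * (|w.1| + |w.2|) + (B j + Ml j) * (Set.indicator {s : ℝ | δ < |s|} (1 : ℝ → ℝ) w.1 + Set.indicator {s : ℝ | δ < |s|} (1 : ℝ → ℝ) w.2) with hmaj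
  have e : (fun w => jweight d w * maj w) = fun w => Ml (j + 1) * (jweight d w * (|w.1| + |w.2|)) +
      (B j + Ml j) * (jweight d w * (Set.indicator {s : ℝ | δ < |s|} (1 : ℝ → ℝ) w.1 + Set.indicator {s : ℝ | δ < |s|} (1 : ℝ → ℝ) w.2)) := by
    funext w; simp only [hmaj]; ring
  have i1 : Integrable (fun w => Ml (j + 1) * (jweight d w * (|w.1| + |w.2|))) jmeas :=
    (integrable_jmeas_of_continuous ((continuous_jweight d).mul (continuous_fst.abs.add continuous_snd.abs))).const_mul _
  have i2 : Integrable (fun w => (B j + Ml j) * (jweight d w * (Set.indicator {s : ℝ | δ < |s|} (1 : ℝ → ℝ) w.1 + Set.indicator {s : ℝ | δ < |s|} (1 : ℝ → ℝ) w.2))) jmeas := by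
    have := ((integrable_jweight_mul_jfar_fst d δ).add (integrable_jweight_mul_jfar_snd d δ)).const_mul (B j + Ml j)
    refine this.congr (Eventually.of_forall fun w => ?_)
    show (B j + Ml j) * (jweight d w * Set.indicator {s : ℝ | δ < |s|} (1 : ℝ → ℝ) w.1 + jweight d w * Set.indicator {s : ℝ | δ < |s|} (1 : ℝ → ℝ) w.2) = _
    ring
  have hint : Integrable (fun w => jweight d w * maj w) jmeas := by rw [e]; exact i1.add i2
  calc ‖∫ w, jweight d w • (iteratedFDeriv ℝ j G (x - jshift w) - iteratedFDeriv ℝ j G x) ∂jmeas‖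
      ≤ ∫ w, ‖jweight d w • (iteratedFDeriv ℝ j G (x - jshift w) - iteratedFDeriv ℝ j G x)‖ ∂jmeas :=
        norm_integral_le_integral_norm _
    _ ≤ ∫ w, jweight d w * maj w ∂jmeas := by
        refine integral_mono_of_nonneg (Eventually.of_forall fun w => norm_nonneg _) hint (Eventually.of_forall fun w => ?_)
        show ‖jweight d w • (iteratedFDeriv ℝ j G (x - jshift w) - iteratedFDeriv ℝ j G x)‖ ≤ jweight d w * maj w
        rw [norm_smul, Real.norm_eq_abs, abs_of_nonneg (jweight_nonneg d w)]
        exact mul_le_mul_of_nonneg_left (norm_iteratedFDeriv_translate_sub_le hG hB hMl hδ hδr hj w) (jweight_nonneg d w)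
    _ = Ml (j + 1) * ∫ w, jweight d w * (|w.1| + |w.2|) ∂jmeas + (B j + Ml j) * ∫ w, jweight d w * (Set.indicator {s : ℝ | δ < |s|} (1 : ℝ → ℝ) w.1 + Set.indicator {s : ℝ | δ < |s|} (1 : ℝ → ℝ) w.2) ∂jmeas := by
        rw [e, integral_add i1 i2, integral_const_mul, integral_const_mul]
    _ ≤ Ml (j + 1) * m₁ + (B j + Ml j) * (π ^ 3 / ((d + 1) * δ) ^ 3) :=
        add_le_add (mul_le_mul_of_nonneg_left hm₁ hM1)
          (mul_le_mul_of_nonneg_left (integral_jweight_mul_jfar_le d hδ hδπ) (add_nonneg hB0 hM0))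

/-- **The Jackson remainder's derivatives from local sizes, no gain** (`j ≤ 4`; the top order):
`‖Dʲ(F − 𝒥_dF)(x)‖ ≤ 2·Ml j + B j·π³/((d+1)δ)³`. -/
theorem norm_iteratedFDeriv_jhigh1_le_local_top (d : ℕ) (hF : Continuous F)
    (hG : ContDiff ℝ 4 (fun q : EuclideanSpace ℝ (Fin 2) => F (WithLp.ofLp q)))
    (hB : ∀ i ≤ 4, ∀ y, ‖iteratedFDeriv ℝ i (fun q : EuclideanSpace ℝ (Fin 2) => F (WithLp.ofLp q)) y‖ ≤ B i)
    (hMl : ∀ i ≤ 4, ∀ y : EuclideanSpace ℝ (Fin 2), ‖y - x‖ ≤ r →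
      ‖iteratedFDeriv ℝ i (fun q : EuclideanSpace ℝ (Fin 2) => F (WithLp.ofLp q)) y‖ ≤ Ml i)
    (hδ : 0 < δ) (hδπ : δ ≤ π) (hδr : 2 * δ ≤ r) {j : ℕ} (hj : j ≤ 4) :
    ‖iteratedFDeriv ℝ j (fun q : EuclideanSpace ℝ (Fin 2) => jhigh1 d F (WithLp.ofLp q)) x‖ ≤
      2 * Ml j + B j * (π ^ 3 / ((d + 1) * δ) ^ 3) := by
  set G : EuclideanSpace ℝ (Fin 2) → ℝ := fun q => F (WithLp.ofLp q) with hGdef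
  have hB0 : 0 ≤ B j := (norm_nonneg _).trans (hB j hj x)
  have hM0 : 0 ≤ Ml j := ml_nonneg hMl hδ hδr hj
  rw [iteratedFDeriv_jhigh1_eq d hF hG hB hj x, norm_neg]
  set maj : ℝ × ℝ → ℝ := fun w => 2 * Ml j + B j * (Set.indicator {s : ℝ | δ < |s|} (1 : ℝ → ℝ) w.1 + Set.indicator {s : ℝ | δ < |s|} (1 : ℝ → ℝ) w.2) with hmaj
  have i1 : Integrable (fun w => jweight d w * (2 * Ml j)) jmeas :=
    (integrable_jmeas_of_continuous (continuous_jweight d)).mul_const _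
  have i2 : Integrable (fun w => B j * (jweight d w * (Set.indicator {s : ℝ | δ < |s|} (1 : ℝ → ℝ) w.1 + Set.indicator {s : ℝ | δ < |s|} (1 : ℝ → ℝ) w.2))) jmeas := by
    have := ((integrable_jweight_mul_jfar_fst d δ).add (integrable_jweight_mul_jfar_snd d δ)).const_mul (B j)
    refine this.congr (Eventually.of_forall fun w => ?_)
    show B j * (jweight d w * Set.indicator {s : ℝ | δ < |s|} (1 : ℝ → ℝ) w.1 + jweight d w * Set.indicator {s : ℝ | δ < |s|} (1 : ℝ → ℝ) w.2) = _
    ring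
  have e : (fun w => jweight d w * maj w) = fun w => jweight d w * (2 * Ml j) + B j * (jweight d w * (Set.indicator {s : ℝ | δ < |s|} (1 : ℝ → ℝ) w.1 + Set.indicator {s : ℝ | δ < |s|} (1 : ℝ → ℝ) w.2)) := by
    funext w; simp only [hmaj]; ring
  have hint : Integrable (fun w => jweight d w * maj w) jmeas := by rw [e]; exact i1.add i2
  calc ‖∫ w, jweight d w • (iteratedFDeriv ℝ j G (x - jshift w) - iteratedFDeriv ℝ j G x) ∂jmeas‖
      ≤ ∫ w, ‖jweight d w • (iteratedFDeriv ℝ j G (x - jshift w) - iteratedFDeriv ℝ j G x)‖ ∂jmeas :=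
        norm_integral_le_integral_norm _
    _ ≤ ∫ w, jweight d w * maj w ∂jmeas := by
        refine integral_mono_of_nonneg (Eventually.of_forall fun w => norm_nonneg _) hint (Eventually.of_forall fun w => ?_)
        show ‖jweight d w • (iteratedFDeriv ℝ j G (x - jshift w) - iteratedFDeriv ℝ j G x)‖ ≤ jweight d w * maj w
        rw [norm_smul, Real.norm_eq_abs, abs_of_nonneg (jweight_nonneg d w)]
        exact mul_le_mul_of_nonneg_left (norm_iteratedFDeriv_translate_sub_le_top hB hMl hδ hδr hj w) (jweight_nonneg d w)
    _ = (2 * Ml j) * ∫ w, jweight d w ∂jmeas + B j * ∫ w, jweight d w * (Set.indicator {s : ℝ | δ < |s|} (1 : ℝ → ℝ) w.1 + Set.indicator {s : ℝ | δ < |s|} (1 : ℝ → ℝ) w.2) ∂jmeas := by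
        rw [e, integral_add i1 i2, integral_mul_const, integral_const_mul]; ring
    _ ≤ 2 * Ml j + B j * (π ^ 3 / ((d + 1) * δ) ^ 3) := by
        rw [integral_jweight, mul_one]
        exact add_le_add le_rfl (mul_le_mul_of_nonneg_left (integral_jweight_mul_jfar_le d hδ hδπ) hB0)

end Local

end Summit.HubbardSuperconductivity.HubbardSuperconductivity.Theorems.KLRegimeSplit

end
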